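import Mathlib
import Summits.KontsevichZagierPeriods.Zeta5Search.Certificates.RecordRayThm1OfN
import Summits.KontsevichZagierPeriods.Zeta5Search.Certificates.RecordRayAperyPQ
import Summits.KontsevichZagierPeriods.Zeta5Search.Certificates.RecordRayAllN
import HarnessLib

/-!
# The typed statement `BrownZudilin2022.theorem1'`, instantiated on the record ray (S4-R1 item #12, fam-tele g17)

HONEST FRAMING: systematic search; no irrationality claim unless certified.  ONE instance, no new mathematics: the glue
`theorem1'_of_eventually_ne` (#11, `RecordRayThm1OfN`) applied to the tree's (E) `aperyType_recordPQ` (#9, the Apéry-type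
recursion of Brown–Zudilin's record pair `P_n`, `Q_n`) and (N ∀ n ≥ 1) `recordForm_ne_zero_all` (#10, gen-2 g32/g33, filed by P1 g15: the
record-cell forms `Q_nζ(5) − P_n` never vanish).  The conclusion is the LITERATURE-typed named statement `theorem1'`
([BrownZudilin2022, Theorem 1] as typed in `Literature/…/BrownZudilin2022/CellularZetaFive.lean`, printed exponent `0.86 < 1`:
it "does not imply the (expected!) irrationality of ζ(5)" — their footnote 1).  Whether and how this instance may be described
relative to the printed theorem (faithfulness of the typed statement: clauses (E), (N), limit, metric exponent) is the
referees' read, not this file's; no number in print moves.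
-/

namespace Summit.KontsevichZagierPeriods.Zeta5Search.RecordRay.Generic

open Filter
open Literature.NumberTheory.Irrationality.BrownZudilin2022 (theorem1')

/-- **`theorem1'` holds**, witnessed by Brown–Zudilin's own record pair `p n = P_n`, `q n = Q_n`: (E) `aperyType_recordPQ`,
(N) `recordForm_ne_zero_all` (all `n ≥ 1`), limit and metric clauses from `RecordRayThm1OfN`.  HONEST FRAMING: the typed
statement's exponent is `0.86 < 1`; no irrationality content. -/
theorem theorem1'_holds : theorem1' :=
  theorem1'_of_eventually_ne aperyType_recordPQ (eventually_atTop.2 ⟨1, fun _ hn => recordForm_ne_zero_all hn⟩)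

end Summit.KontsevichZagierPeriods.Zeta5Search.RecordRay.Generic
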